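import Summits.PneNP.PneNP.Theorems.ChebyshevTracialDesignJuntaCount
import HarnessLib

/-!
# Junta virtual positivity, part D: perfect matchings with a prescribed number of crossing edges

Support file for the crux `TracialDecayExp20` (stmt-PneNP-19878) of route `ChebyshevTracialDesign`
(cell pnp-psdrank, local virtual positivity (N1), MATCHING-SIDE twin: the design value of a psd pair whose
MATCHING-side factor `Y_M` depends only on the edges of `M` at a small window is `≤ 0`). This part counts,
for a fixed cut `U ⊆ S` with `|U| = a + 2i`, `|S \ U| = a + 2i'`, the perfect matchings `M` of `S` with
exactly `a` edges crossing `U`: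
`#{M} · (a! · 2^i i! · 2^{i'} i'!) = (a + 2i)! · (a + 2i')!` (`card_pm_filter_cr_mul`),
by the partner recursion (remove `v ∈ U` with its partner); the count vanishes outside this range
(`pm_filter_cr_eq_empty`). Notation as in part A (`#cr(U,M) = #{e ∈ M | cutCount U e = 1}`); no definitions.
-/

set_option linter.dupNamespace false -- `Summit.PneNP.PneNP.…`: summit = sub-problem (D-0017)

namespace Summit.PneNP.PneNP.Theorems.ChebyshevTracialDesignJunta

open Finset Literature.Barriers.PneNP Literature.Combinatorics.SimpleGraph.CycleSpace

variable {V : Type*} [DecidableEq V]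

/-! ### Complement symmetry and the range of the crossing count -/

/-- `cutCount (S \ U) e = 2 - cutCount U e` for an edge inside `S`. [folklore] -/
theorem cutCount_sdiff {S U : Finset V} {e : Sym2 V} (he : e ∈ S.sym2) :
    cutCount (S \ U) e = 2 - cutCount U e := by
  induction e using Sym2.ind with
  | h a b =>
    rw [mem_sym2_iff] at he
    have ha : a ∈ S := he a (Sym2.mem_mk_left a b)
    have hb : b ∈ S := he b (Sym2.mem_mk_right a b)
    simp only [cutCount_mk, mem_sdiff, ha, hb, true_and]
    by_cases hau : a ∈ U <;> by_cases hbu : b ∈ U <;> simp [hau, hbu]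

/-- The crossing count is symmetric in `U ↔ S \ U`. [folklore] -/
theorem card_filter_cr_sdiff {S U : Finset V} {M : Finset (Sym2 V)} (hM : M ⊆ S.sym2) :
    (M.filter fun e => cutCount (S \ U) e = 1).card = (M.filter fun e => cutCount U e = 1).card := by
  congr 1
  refine filter_congr fun e he => ?_
  rw [cutCount_sdiff (hM he)]
  have := cutCount_le_two U e
  omega

/-- **Range of the crossing count**: a perfect matching of `S` with `a` edges crossing `U` forces
`a ≤ |U|`, `a ≤ |S \ U|` and both differences even; otherwise there is no such matching. [folklore] -/
theorem pm_filter_cr_eq_empty {S U : Finset V} (hU : U ⊆ S) {a : ℕ}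
    (h : ¬ (a ≤ U.card ∧ a ≤ (S \ U).card ∧ Even (U.card - a) ∧ Even ((S \ U).card - a))) :
    ((perfectMatchings S).filter fun M => (M.filter fun e => cutCount U e = 1).card = a) = ∅ := by
  rw [filter_eq_empty_iff]
  intro M hM ha
  rw [mem_perfectMatchings] at hM
  apply h
  have h1 := card_eq_cr_add_two_mul_in hM hU
  have h2 := card_eq_cr_add_two_mul_in hM (sdiff_subset (s := S) (t := U))
  rw [card_filter_cr_sdiff hM.1, ha] at h2
  rw [ha] at h1
  refine ⟨by omega, by omega, ⟨(M.filter fun e => cutCount U e = 2).card, by omega⟩,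
    ⟨(M.filter fun e => cutCount (S \ U) e = 2).card, by omega⟩⟩

/-! ### Partition by the partner of a vertex -/

/-- **Partition of the perfect matchings of `S` by the partner of a fixed vertex `v ∈ S`.** [folklore] -/
theorem card_pm_filter_eq_sum_partner {S : Finset V} {v : V} (hv : v ∈ S) (P : Finset (Sym2 V) → Prop)
    [DecidablePred P] :
    ((perfectMatchings S).filter P).card =
      ∑ u ∈ S.erase v, ((perfectMatchings S).filter fun M => s(v, u) ∈ M ∧ P M).card := by
  rw [← card_biUnion]
  · congr 1
    ext M
    simp only [mem_filter, mem_biUnion, mem_erase, mem_perfectMatchings]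
    constructor
    · rintro ⟨hM, hP⟩
      obtain ⟨e, he, hve⟩ := hM.exists_mem hv
      have heq : s(v, Sym2.Mem.other hve) = e := Sym2.other_spec hve
      refine ⟨Sym2.Mem.other hve, ⟨?_, ?_⟩, hM, (by rw [heq]; exact he), hP⟩
      · intro huv
        apply hM.not_isDiag he
        rw [← heq, huv]
        exact Sym2.mk_isDiag_iff.2 rfl
      · exact hM.mem_of_mem he (Sym2.other_mem hve)
    · rintro ⟨u, -, hM, -, hP⟩; exact ⟨hM, hP⟩
  · intro u hu u' hu' huu'
    simp only [Function.onFun]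
    rw [Finset.disjoint_left]
    intro M hM hM'
    rw [mem_filter, mem_perfectMatchings] at hM hM'
    have := hM.1.unique hM.2.1 hM'.2.1 (Sym2.mem_mk_left v u) (Sym2.mem_mk_left v u')
    exact huu' (Sym2.congr_right.1 this)

/-- **Removing the edge at `v`**: perfect matchings of `S` through the edge `vu` with `a` crossing edges
correspond (`M ↦ M.erase vu`) to perfect matchings of `S \ {v,u}` whose crossing count, plus that of the edge
`vu`, is `a`. [folklore] -/
theorem card_pm_filter_edge {S : Finset V} {v u : V} (hv : v ∈ S) (hu : u ∈ S) (hvu : v ≠ u)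
    (U : Finset V) (a : ℕ) :
    ((perfectMatchings S).filter fun M => s(v, u) ∈ M ∧ (M.filter fun e => cutCount U e = 1).card = a).card =
      ((perfectMatchings (S \ {v, u})).filter fun M' =>
        (({s(v, u)} : Finset (Sym2 V)).filter fun e => cutCount U e = 1).card +
          (M'.filter fun e => cutCount (U ∩ (S \ {v, u})) e = 1).card = a).card := by
  have hpair : ({v, u} : Finset V) ⊆ S := by
    rw [insert_subset_iff, singleton_subset_iff]; exact ⟨hv, hu⟩
  have hS : S = {v, u} ∪ (S \ {v, u}) := (union_sdiff_of_subset hpair).symm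
  have hd : Disjoint ({v, u} : Finset V) (S \ {v, u}) := disjoint_sdiff
  have he1 : ({s(v, u)} : Finset (Sym2 V)) ⊆ ({v, u} : Finset V).sym2 := by
    intro e he; rw [mem_singleton] at he; subst he; simp
  -- crossing count of a matching through `vu`
  have hsplit : ∀ M' : Finset (Sym2 V), IsPMOn (S \ {v, u}) M' →
      ((insert s(v, u) M').filter fun e => cutCount U e = 1).card =
        (({s(v, u)} : Finset (Sym2 V)).filter fun e => cutCount U e = 1).card +
          (M'.filter fun e => cutCount (U ∩ (S \ {v, u})) e = 1).card := by
    intro M' hM'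
    rw [insert_eq, card_filter_cutCount_union (disjoint_of_subset_sym2 hd he1 hM'.1),
      card_filter_cutCount_inter hM'.1]
  refine card_nbij' (fun M => M.erase s(v, u)) (fun M' => insert s(v, u) M') ?_ ?_ ?_ ?_
  · intro M hM
    simp only [mem_coe, mem_filter, mem_perfectMatchings] at hM ⊢
    obtain ⟨hM, he, ha⟩ := hM
    have h' : IsPMOn ({v, u} ∪ (S \ {v, u})) M := by rwa [← hS]
    have hM' : IsPMOn (S \ {v, u}) (M.erase s(v, u)) := by
      rw [← sdiff_singleton_eq_erase]
      exact h'.sdiff hd (IsPMOn.pair hvu) (singleton_subset_iff.2 he)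
    refine ⟨hM', ?_⟩
    rw [← hsplit _ hM', insert_erase he, ha]
  · intro M' hM'
    simp only [mem_coe, mem_filter, mem_perfectMatchings] at hM' ⊢
    obtain ⟨hM', ha⟩ := hM'
    have hM : IsPMOn S (insert s(v, u) M') := by
      rw [hS, insert_eq]
      exact (IsPMOn.pair hvu).union hM' hd
    exact ⟨hM, mem_insert_self _ _, by rw [hsplit _ hM', ha]⟩
  · intro M hM
    simp only [mem_coe, mem_filter] at hM
    exact insert_erase hM.2.1
  · intro M' hM'
    simp only [mem_coe, mem_filter, mem_perfectMatchings] at hM'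
    have hne : s(v, u) ∉ M' := fun h => by
      have := mem_sym2_iff.1 (hM'.1.1 h) v (Sym2.mem_mk_left v u)
      simp at this
    exact erase_insert hne

/-! ### The closed form -/

/-- Single-edge crossing counts: an edge inside `U` is not crossing, an edge from `U` to its complement is.
[folklore] -/
theorem card_filter_singleton_cutCount {U : Finset V} {v u : V} (hv : v ∈ U) :
    ((u ∈ U → (({s(v, u)} : Finset (Sym2 V)).filter fun e => cutCount U e = 1).card = 0)) ∧
    (u ∉ U → (({s(v, u)} : Finset (Sym2 V)).filter fun e => cutCount U e = 1).card = 1) := by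
  constructor <;> intro hu <;> simp [filter_singleton, cutCount_mk, hv, hu]

/-- **The step of the partner recursion** (`v ∈ U`), with the induction hypothesis for smaller vertex sets as
an explicit hypothesis. [folklore] -/
theorem card_pm_filter_cr_step {S U : Finset V} (hU : U ⊆ S) {v : V} (hv : v ∈ U) {a i i' : ℕ}
    (hUc : U.card = a + 2 * i) (hSc : (S \ U).card = a + 2 * i')
    (IH : ∀ S' : Finset V, S'.card < S.card → ∀ U' : Finset V, U' ⊆ S' → ∀ a i i' : ℕ,
      U'.card = a + 2 * i → (S' \ U').card = a + 2 * i' →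
      ((perfectMatchings S').filter fun M => (M.filter fun e => cutCount U' e = 1).card = a).card *
        (a.factorial * (2 ^ i * i.factorial) * (2 ^ i' * i'.factorial)) =
          (a + 2 * i).factorial * (a + 2 * i').factorial) :
    ((perfectMatchings S).filter fun M => (M.filter fun e => cutCount U e = 1).card = a).card *
        (a.factorial * (2 ^ i * i.factorial) * (2 ^ i' * i'.factorial)) =
      (a + 2 * i).factorial * (a + 2 * i').factorial := by
  have hvS : v ∈ S := hU hv
  rw [card_pm_filter_eq_sum_partner hvS]
  -- split the partners into `U.erase v` and `S \ U`
  have hsplit : S.erase v = U.erase v ∪ (S \ U) := by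
    ext u
    simp only [mem_erase, mem_union, mem_sdiff]
    constructor
    · rintro ⟨huv, huS⟩
      by_cases huU : u ∈ U
      · exact Or.inl ⟨huv, huU⟩
      · exact Or.inr ⟨huS, huU⟩
    · rintro (⟨huv, huU⟩ | ⟨huS, huU⟩)
      · exact ⟨huv, hU huU⟩
      · exact ⟨fun h => huU (h ▸ hv), huS⟩
  have hdisj : Disjoint (U.erase v) (S \ U) := disjoint_left.2 fun u hu hu' => (mem_sdiff.1 hu').2 (mem_of_mem_erase hu)
  rw [hsplit, sum_union hdisj]
  -- the sub-configuration after removing `v` and a partner `u`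
  have hcardS : ∀ u ∈ S, u ≠ v → (S \ {v, u}).card = S.card - 2 := by
    intro u hu huv
    have hp : ({v, u} : Finset V) ⊆ S := by
      rw [insert_subset_iff, singleton_subset_iff]; exact ⟨hvS, hu⟩
    rw [card_sdiff_of_subset hp, card_pair huv.symm]
  have hlt : ∀ u ∈ S, u ≠ v → (S \ {v, u}).card < S.card := by
    intro u hu huv
    rw [hcardS u hu huv]; have : 0 < S.card := card_pos.2 ⟨v, hvS⟩; omega
  -- internal partners
  have hint : ∀ u ∈ U.erase v,
      ((perfectMatchings S).filter fun M =>
          s(v, u) ∈ M ∧ (M.filter fun e => cutCount U e = 1).card = a).card *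
        (a.factorial * (2 ^ i * i.factorial) * (2 ^ i' * i'.factorial)) =
      (if 1 ≤ i then 2 * i * ((a + 2 * (i - 1)).factorial * (a + 2 * i').factorial) else 0) := by
    intro u hu
    obtain ⟨huv, huU⟩ := mem_erase.1 hu
    rw [card_pm_filter_edge hvS (hU huU) (Ne.symm huv) U a, (card_filter_singleton_cutCount hv).1 huU]
    simp only [zero_add]
    have hU' : U ∩ (S \ {v, u}) = U \ {v, u} := by
      ext w; simp only [mem_inter, mem_sdiff, mem_insert, mem_singleton]
      constructor
      · rintro ⟨hwU, -, hw⟩; exact ⟨hwU, hw⟩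
      · rintro ⟨hwU, hw⟩; exact ⟨hwU, hU hwU, hw⟩
    have hsub : U \ {v, u} ⊆ S \ {v, u} := sdiff_subset_sdiff hU Subset.rfl
    have hp : ({v, u} : Finset V) ⊆ U := by
      rw [insert_subset_iff, singleton_subset_iff]; exact ⟨hv, huU⟩
    have hcU : (U \ {v, u}).card = U.card - 2 := by rw [card_sdiff_of_subset hp, card_pair (Ne.symm huv)]
    have hcS : ((S \ {v, u}) \ (U \ {v, u})).card = a + 2 * i' := by
      have : (S \ {v, u}) \ (U \ {v, u}) = S \ U := by
        ext w; simp only [mem_sdiff, mem_insert, mem_singleton]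
        constructor
        · rintro ⟨⟨hwS, hw⟩, hw'⟩
          exact ⟨hwS, fun hwU => hw' ⟨hwU, hw⟩⟩
        · rintro ⟨hwS, hwU⟩
          refine ⟨⟨hwS, ?_⟩, fun h => hwU h.1⟩
          rintro (rfl | rfl)
          · exact hwU hv
          · exact hwU huU
      rw [this, hSc]
    rw [hU']
    split_ifs with hi
    · have hcU' : (U \ {v, u}).card = a + 2 * (i - 1) := by rw [hcU, hUc]; omega
      have key := IH (S \ {v, u}) (hlt u (hU huU) huv) (U \ {v, u}) hsub a (i - 1) i' hcU' hcS
      -- K(a,i,i') = K(a,i-1,i') · 2i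
      obtain ⟨j, rfl⟩ : ∃ j, i = j + 1 := ⟨i - 1, by omega⟩
      simp only [Nat.add_sub_cancel] at key ⊢
      rw [show a.factorial * (2 ^ (j + 1) * (j + 1).factorial) * (2 ^ i' * i'.factorial) =
          (a.factorial * (2 ^ j * j.factorial) * (2 ^ i' * i'.factorial)) * (2 * (j + 1)) by
        rw [pow_succ, Nat.factorial_succ]; ring]
      rw [← mul_assoc, key]
      ring
    · -- `i = 0`: the cut `U \ {v,u}` has `a - 2 < a` elements, no matching has `a` crossing edges
      have hi0 : i = 0 := by omega
      subst hi0
      have hUpos : 0 < U.card := card_pos.2 ⟨v, hv⟩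
      rw [pm_filter_cr_eq_empty (S := S \ {v, u}) hsub (a := a) (fun h => by
        have h1 := h.1; rw [hcU, hUc] at h1; omega), card_empty, zero_mul]
  -- crossing partners
  have hext : ∀ u ∈ S \ U,
      ((perfectMatchings S).filter fun M =>
          s(v, u) ∈ M ∧ (M.filter fun e => cutCount U e = 1).card = a).card *
        (a.factorial * (2 ^ i * i.factorial) * (2 ^ i' * i'.factorial)) =
      (if 1 ≤ a then a * ((a - 1 + 2 * i).factorial * (a - 1 + 2 * i').factorial) else 0) := by
    intro u hu
    obtain ⟨huS, huU⟩ := mem_sdiff.1 hu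
    have huv : u ≠ v := fun h => huU (h ▸ hv)
    rw [card_pm_filter_edge hvS huS (Ne.symm huv) U a, (card_filter_singleton_cutCount hv).2 huU]
    have hU' : U ∩ (S \ {v, u}) = U.erase v := by
      ext w; simp only [mem_inter, mem_sdiff, mem_insert, mem_singleton, mem_erase]
      constructor
      · rintro ⟨hwU, -, hw⟩; exact ⟨fun h => hw (Or.inl h), hwU⟩
      · rintro ⟨hwv, hwU⟩; exact ⟨hwU, hU hwU, fun h => h.elim hwv fun h' => huU (h' ▸ hwU)⟩
    have hsub : U.erase v ⊆ S \ {v, u} := by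
      intro w hw
      obtain ⟨hwv, hwU⟩ := mem_erase.1 hw
      simp only [mem_sdiff, mem_insert, mem_singleton]
      exact ⟨hU hwU, fun h => h.elim hwv fun h' => huU (h' ▸ hwU)⟩
    have hcS : ((S \ {v, u}) \ U.erase v).card = (S \ U).card - 1 := by
      have : (S \ {v, u}) \ U.erase v = (S \ U).erase u := by
        ext w; simp only [mem_sdiff, mem_insert, mem_singleton, mem_erase]
        constructor
        · rintro ⟨⟨hwS, hw⟩, hw'⟩
          refine ⟨fun h => hw (Or.inr h), hwS, fun hwU => hw' ⟨fun h => hw (Or.inl h), hwU⟩⟩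
        · rintro ⟨hwu, hwS, hwU⟩
          exact ⟨⟨hwS, fun h => h.elim (fun h' => hwU (h' ▸ hv)) hwu⟩, fun h => hwU h.2⟩
      rw [this, card_erase_of_mem hu]
    rw [hU']
    split_ifs with ha
    · have hfilt : ((perfectMatchings (S \ {v, u})).filter fun M' =>
            1 + (M'.filter fun e => cutCount (U.erase v) e = 1).card = a) =
          (perfectMatchings (S \ {v, u})).filter fun M' =>
            (M'.filter fun e => cutCount (U.erase v) e = 1).card = a - 1 :=
        filter_congr fun M' _ => by omega
      rw [hfilt]
      have hcU' : (U.erase v).card = (a - 1) + 2 * i := by rw [card_erase_of_mem hv, hUc]; omega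
      have hcS' : ((S \ {v, u}) \ U.erase v).card = (a - 1) + 2 * i' := by rw [hcS, hSc]; omega
      have key := IH (S \ {v, u}) (hlt u huS huv) (U.erase v) hsub (a - 1) i i' hcU' hcS'
      obtain ⟨b, rfl⟩ : ∃ b, a = b + 1 := ⟨a - 1, by omega⟩
      simp only [Nat.add_sub_cancel] at key ⊢
      rw [show (b + 1).factorial * (2 ^ i * i.factorial) * (2 ^ i' * i'.factorial) =
          (b.factorial * (2 ^ i * i.factorial) * (2 ^ i' * i'.factorial)) * (b + 1) by
        rw [Nat.factorial_succ]; ring]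
      rw [← mul_assoc, key]
      ring
    · have ha0 : a = 0 := by omega
      subst ha0
      have : ((perfectMatchings (S \ {v, u})).filter fun M' =>
          1 + (M'.filter fun e => cutCount (U.erase v) e = 1).card = 0) = ∅ :=
        filter_eq_empty_iff.2 fun M' _ h => by omega
      rw [this, card_empty, zero_mul]
  rw [add_mul, sum_mul, sum_mul, sum_congr rfl hint, sum_congr rfl hext, sum_const, sum_const,
    smul_eq_mul, smul_eq_mul, hSc]
  have hpe : (U.erase v).card + 1 = a + 2 * i := by
    rw [card_erase_of_mem hv, hUc]; have := card_pos.2 ⟨v, hv⟩; omega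
  -- the arithmetic `(p-1)·2i·(p-2)!q! + q·a·(p-1)!(q-1)! = p!q!`
  rcases Nat.eq_zero_or_pos i with hi0 | hipos
  · subst hi0
    rcases Nat.eq_zero_or_pos a with ha0 | hapos
    · subst ha0; simp at hUc; exact absurd hv (by rw [hUc]; exact notMem_empty v)
    · obtain ⟨b, rfl⟩ : ∃ b, a = b + 1 := ⟨a - 1, by omega⟩
      rw [if_neg (by omega), if_pos (by omega)]
      simp only [Nat.add_sub_cancel, mul_zero, add_zero, zero_add]
      have e1 : (b + 1 + 2 * i').factorial = (b + 1 + 2 * i') * (b + 2 * i').factorial := by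
        rw [show b + 1 + 2 * i' = (b + 2 * i') + 1 by ring, Nat.factorial_succ]
      rw [e1, Nat.factorial_succ b]
      ring
  · obtain ⟨j, rfl⟩ : ∃ j, i = j + 1 := ⟨i - 1, by omega⟩
    rw [if_pos (by omega)]
    rcases Nat.eq_zero_or_pos a with ha0 | hapos
    · subst ha0
      rw [if_neg (by omega)]
      have hc : (U.erase v).card = 2 * j + 1 := by omega
      rw [hc]
      simp only [zero_add, Nat.add_sub_cancel, mul_zero, add_zero]
      have e1 : (2 * (j + 1)).factorial = (2 * j + 2) * ((2 * j + 1) * (2 * j).factorial) := by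
        rw [show 2 * (j + 1) = (2 * j + 1) + 1 by ring, Nat.factorial_succ, Nat.factorial_succ]
      rw [e1]
      ring
    · obtain ⟨b, rfl⟩ : ∃ b, a = b + 1 := ⟨a - 1, by omega⟩
      rw [if_pos (by omega)]
      have hc : (U.erase v).card = b + 2 * j + 2 := by omega
      rw [hc]
      simp only [Nat.add_sub_cancel]
      have e1 : (b + 1 + 2 * j).factorial = (b + 2 * j + 1).factorial := by
        rw [show b + 1 + 2 * j = b + 2 * j + 1 by ring]
      have e2 : (b + 2 * (j + 1)).factorial = (b + 2 * j + 2) * (b + 2 * j + 1).factorial := by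
        rw [show b + 2 * (j + 1) = (b + 2 * j + 1) + 1 by ring, Nat.factorial_succ]
      have e3 : (b + 1 + 2 * (j + 1)).factorial = (b + 2 * j + 3) * ((b + 2 * j + 2) * (b + 2 * j + 1).factorial) := by
        rw [show b + 1 + 2 * (j + 1) = (b + 2 * j + 1) + 1 + 1 by ring, Nat.factorial_succ, Nat.factorial_succ]
      have e4 : (b + 1 + 2 * i').factorial = (b + 2 * i' + 1) * (b + 2 * i').factorial := by
        rw [show b + 1 + 2 * i' = (b + 2 * i') + 1 by ring, Nat.factorial_succ]
      rw [e1, e2, e3, e4]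
      ring


/-- **Closed form for the number of perfect matchings with `a` crossing edges**: for `U ⊆ S` with
`|U| = a + 2i`, `|S \ U| = a + 2i'`, `#{M ∈ PM(S) : #cr(U,M) = a} · (a!·2^i i!·2^{i'} i'!) = (a+2i)!·(a+2i')!`
(i.e. the count is `C(a+2i,a) C(a+2i',a) a! (2i-1)!! (2i'-1)!!`). [folklore] -/
theorem card_pm_filter_cr_mul_aux : ∀ (m : ℕ) (S : Finset V), S.card = m → ∀ U : Finset V, U ⊆ S →
    ∀ a i i' : ℕ, U.card = a + 2 * i → (S \ U).card = a + 2 * i' →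
      ((perfectMatchings S).filter fun M => (M.filter fun e => cutCount U e = 1).card = a).card *
        (a.factorial * (2 ^ i * i.factorial) * (2 ^ i' * i'.factorial)) =
          (a + 2 * i).factorial * (a + 2 * i').factorial := by
  intro m
  induction m using Nat.strong_induction_on with
  | _ m IHm =>
    intro S hSm U hU a i i' hUc hSc
    have IH : ∀ S' : Finset V, S'.card < S.card → ∀ U' : Finset V, U' ⊆ S' → ∀ a i i' : ℕ,
        U'.card = a + 2 * i → (S' \ U').card = a + 2 * i' →
        ((perfectMatchings S').filter fun M => (M.filter fun e => cutCount U' e = 1).card = a).card *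
          (a.factorial * (2 ^ i * i.factorial) * (2 ^ i' * i'.factorial)) =
            (a + 2 * i).factorial * (a + 2 * i').factorial :=
      fun S' hS' U' hU' a i i' h1 h2 => IHm S'.card (hSm ▸ hS') S' rfl U' hU' a i i' h1 h2
    rcases U.eq_empty_or_nonempty with hU0 | ⟨v, hv⟩
    · -- `U = ∅`: then `a = i = 0`; pass to the complement cut `S`
      subst hU0
      rw [card_empty] at hUc
      have ha : a = 0 := by omega
      have hi : i = 0 := by omega
      subst ha; subst hi
      rw [sdiff_empty] at hSc
      rcases S.eq_empty_or_nonempty with hS0 | ⟨v, hvS⟩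
      · subst hS0
        rw [card_empty] at hSc
        have hi' : i' = 0 := by omega
        subst hi'
        have h1 : perfectMatchings (∅ : Finset V) = {∅} := by
          ext M
          rw [mem_perfectMatchings, mem_singleton]
          exact ⟨IsPMOn.eq_empty, fun h => h ▸ IsPMOn.empty⟩
        rw [h1, filter_singleton, if_pos (by simp)]
        simp
      · have hsym : ((perfectMatchings S).filter fun M =>
              (M.filter fun e => cutCount (∅ : Finset V) e = 1).card = 0).card =
            ((perfectMatchings S).filter fun M => (M.filter fun e => cutCount S e = 1).card = 0).card := by
          congr 1
          refine filter_congr fun M hM => ?_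
          rw [mem_perfectMatchings] at hM
          have := card_filter_cr_sdiff (U := S) hM.1
          rw [sdiff_self, bot_eq_empty] at this
          rw [this]
        rw [hsym]
        have key := card_pm_filter_cr_step (S := S) (U := S) Subset.rfl hvS (a := 0) (i := i') (i' := 0)
          (by rw [hSc]) (by rw [sdiff_self, bot_eq_empty, card_empty]) IH
        rw [show Nat.factorial 0 * (2 ^ 0 * Nat.factorial 0) * (2 ^ i' * i'.factorial) =
            Nat.factorial 0 * (2 ^ i' * i'.factorial) * (2 ^ 0 * Nat.factorial 0) by ring, key]
        ring
    · exact card_pm_filter_cr_step hU hv hUc hSc IH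

/-- **Closed form** (see `card_pm_filter_cr_mul_aux`). [folklore] -/
theorem card_pm_filter_cr_mul {S U : Finset V} (hU : U ⊆ S) {a i i' : ℕ} (hUc : U.card = a + 2 * i)
    (hSc : (S \ U).card = a + 2 * i') :
    ((perfectMatchings S).filter fun M => (M.filter fun e => cutCount U e = 1).card = a).card *
        (a.factorial * (2 ^ i * i.factorial) * (2 ^ i' * i'.factorial)) =
      (a + 2 * i).factorial * (a + 2 * i').factorial :=
  card_pm_filter_cr_mul_aux S.card S rfl U hU a i i' hUc hSc

end Summit.PneNP.PneNP.Theorems.ChebyshevTracialDesignJunta
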